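import Literature.NumberTheory.GaloisCohomology.Howard2004.DVRKolyvaginBound
import Literature.Algebra.Module.AddSubgroupRelIndexBookkeepingProofs
import HarnessLib

/-!
# The local index of Howard's propagated condition `condA` under a level-shifted relaxed condition (theorems only)

`Proofs` file (THEOREMS ONLY; no definition, no named fact, no instance, no `sorry`) in topic `NumberTheory/GaloisCohomology/Howard2004`
(currency of `DVRKolyvaginBound`: `AdicTower.incLocIter`, `AdicTower.condA`).  Cell `pub/bsd-print-x9`, shared μ-crux
stmt-BirchSwinnertonDyer-23428, clause (B5) letter `Stmt.readoutLocalIndexP` («`∃ Fv, (hS′) ∧ Finite (↥Fv ⧸ (condA …).addSubgroupOf Fv) ∧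
Nat.card (…) ≤ p ^ c`»), ruling x10b-p2 LEAD g8 2026-08-28T22:46:37Z (3): at an anomalous `v ∣ p` the relaxed condition is the LEVEL
SHIFT `Fv := F′.comap (incLocIter j v e)` of a condition `F′` at level `j + e`.

* `AdicTower.comap_incLocIter_le_condA` — `(F (j+e) v).comap (incLocIter j v e) ≤ condA F j v` (the `d := e` term of the `⨆`).
* **`AdicTower.finite_and_natCard_comap_incLocIter_quotient_condA_le`** — for ANY subgroups `core ≤ F′` of `H¹(K_v, T_{j+e})` with
  `[F′ : core] ≤ B₁` and `[core : core ∩ F (j+e) v] ≤ B₂` (finite): `Fv := F′.comap (incLocIter j v e)` has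
  `Finite (↥Fv ⧸ (condA F j v).addSubgroupOf Fv)` and `Nat.card (…) ≤ B₁ * B₂`.
  (At `v ∣ p`: `F′` = classes with principal graded readout over `K_{∞,w}` (`B₁ = p^{p^s}`, `ZpExtensionEisensteinGradedInvariantsBoundProofs`),
  `core` = the strict ordinary core (`B₂ = p^{p^s}`, `ZpExtensionEisensteinOrdinaryCoreSaturationIndexProofs`).)

References: [Howard2004HeegnerKolyvagin] B. Howard, Compositio Math. 140 (2004), Def. 2.1.1, Prop. 2.2.8, Lemma 3.2.7 and proof of Thm. 2.2.10
(arXiv:1202.6340 p. 15–18); [MazurRubinMemoirs2004] Prop. 5.3.14; [SerreGaloisCohomology1997] Local Fields XIII §1.  BSD is not proved by any of this.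
-/

set_option autoImplicit false

noncomputable section

open Function NumberField IsDedekindDomain Field
open scoped NumberField ContRepresentation

namespace Literature.NumberTheory.GaloisCohomology.Howard2004

open Literature.NumberTheory.GaloisRepresentations
open Literature.NumberTheory.GaloisRepresentations.DiscreteGaloisModule

namespace AdicTower

variable {K : Type} [Field K] [NumberField K] {R : Type} [CommRing R] [IsLocalRing R]
  {N : ℕ → Type} [∀ k, AddCommGroup (N k)] [∀ k, TopologicalSpace (N k)] [∀ k, DiscreteTopology (N k)]
  [∀ k, Module R (N k)]
  (T : AdicTower K R N) (π : R) (e : ℕ → ℕ)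
  (hkill : ∀ k, ∀ r ∈ IsLocalRing.maximalIdeal R ^ e k, ∀ x : N k, r • x = 0)
  (hker : ∀ k, LinearMap.ker (T.red k) = (IsLocalRing.maximalIdeal R ^ e k) • (⊤ : Submodule R (N (k + 1))))
  (hπ : π ∈ IsLocalRing.maximalIdeal R) (he : ∀ k, e k ≤ e (k + 1))

/-- **The `d := d₀` term of `condA`**: a class whose image `d₀` levels up lies in `F_{j+d₀}` lies in `condA F j`.
[cite: Howard2004HeegnerKolyvagin, §1.6 (arXiv p. 11, L18–20) with Def. 2.1.1 (propagation)] -/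
theorem comap_incLocIter_le_condA (F : ∀ k, SelmerStructure (T.ρ k)) (j : ℕ) (v : Place K) (d₀ : ℕ) :
    (F (j + d₀) v).comap (incLocIter T π e hkill hker hπ he j v d₀) ≤ condA T π e hkill hker hπ he F j v :=
  le_iSup (fun d ↦ (F (j + d) v).comap (incLocIter T π e hkill hker hπ he j v d)) d₀

/-- **The level-shifted local index.**  For subgroups `core ≤ F′` of `H¹(K_v, T_{j+d₀})` with `[F′ : core] ≤ B₁` and
`[core : core ∩ F_{j+d₀}(v)] ≤ B₂` (both finite), the shifted condition `Fv := F′.comap (incLocIter j v d₀)` at level `j` satisfies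
`Finite (↥Fv ⧸ (condA F j v).addSubgroupOf Fv)` and `#(↥Fv ⧸ …) ≤ B₁ · B₂`: `condA ⊇ F_{j+d₀}.comap`, the comap injects the quotient
into `F′ ⧸ F′ ∩ F_{j+d₀}`, and `[F′ : F′ ∩ F] ≤ [F′ : core]·[core : core ∩ F]`.  This is the index conjunct of the letter
`Stmt.readoutLocalIndexP` at an (anomalous) place above `p`.
[cite: Howard2004HeegnerKolyvagin, Prop. 2.2.8, Lemma 3.2.7 and proof of Thm. 2.2.10 (arXiv:1202.6340 p. 16–18)] [cite: MazurRubinMemoirs2004, Prop. 5.3.14] -/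
theorem finite_and_natCard_comap_incLocIter_quotient_condA_le (F : ∀ k, SelmerStructure (T.ρ k)) (j : ℕ) (v : Place K)
    (d₀ : ℕ) (F' core : AddSubgroup (galoisCohomology ((T.ρ (j + d₀)).toLocal v) 1)) (hcore : core ≤ F')
    [Finite (↥F' ⧸ core.addSubgroupOf F')] [Finite (↥core ⧸ (F (j + d₀) v).addSubgroupOf core)]
    (B₁ B₂ : ℕ) (h₁ : Nat.card (↥F' ⧸ core.addSubgroupOf F') ≤ B₁)
    (h₂ : Nat.card (↥core ⧸ (F (j + d₀) v).addSubgroupOf core) ≤ B₂) :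
    Finite (↥(F'.comap (incLocIter T π e hkill hker hπ he j v d₀)) ⧸
        (condA T π e hkill hker hπ he F j v).addSubgroupOf (F'.comap (incLocIter T π e hkill hker hπ he j v d₀))) ∧
      Nat.card (↥(F'.comap (incLocIter T π e hkill hker hπ he j v d₀)) ⧸
          (condA T π e hkill hker hπ he F j v).addSubgroupOf (F'.comap (incLocIter T π e hkill hker hπ he j v d₀))) ≤
        B₁ * B₂ := by
  -- `[F′ : F′ ∩ F_{j+d₀}] ≤ [F′ : core]·[core : core ∩ F_{j+d₀}] ≤ B₁ B₂`
  obtain ⟨hfinF, hleF⟩ := AddSubgroup.finite_and_natCard_quotient_addSubgroupOf_le_mul F' core (F (j + d₀) v) hcore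
  haveI := hfinF
  -- pull back along the shift
  obtain ⟨hfinC, hleC⟩ := AddSubgroup.finite_and_natCard_comap_quotient_le
    (incLocIter T π e hkill hker hπ he j v d₀) F' (F (j + d₀) v)
  haveI := hfinC
  -- `condA ⊇ F_{j+d₀}.comap`, as subgroups of `Fv`
  have hle : ((F (j + d₀) v).comap (incLocIter T π e hkill hker hπ he j v d₀)).addSubgroupOf
        (F'.comap (incLocIter T π e hkill hker hπ he j v d₀)) ≤
      (condA T π e hkill hker hπ he F j v).addSubgroupOf (F'.comap (incLocIter T π e hkill hker hπ he j v d₀)) :=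
    fun x hx ↦ comap_incLocIter_le_condA T π e hkill hker hπ he F j v d₀ hx
  -- quotient by the bigger subgroup `condA` is a quotient of the quotient by `F_{j+d₀}.comap`
  let q := QuotientAddGroup.map
    (((F (j + d₀) v).comap (incLocIter T π e hkill hker hπ he j v d₀)).addSubgroupOf
      (F'.comap (incLocIter T π e hkill hker hπ he j v d₀)))
    ((condA T π e hkill hker hπ he F j v).addSubgroupOf (F'.comap (incLocIter T π e hkill hker hπ he j v d₀)))
    (AddMonoidHom.id _) (fun x hx ↦ hle hx)
  have hq : Function.Surjective q := by
    intro y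
    obtain ⟨x, rfl⟩ := QuotientAddGroup.mk_surjective y
    exact ⟨QuotientAddGroup.mk x, rfl⟩
  refine ⟨Finite.of_surjective q hq, ?_⟩
  calc Nat.card _ ≤ Nat.card (↥(F'.comap (incLocIter T π e hkill hker hπ he j v d₀)) ⧸
          ((F (j + d₀) v).comap (incLocIter T π e hkill hker hπ he j v d₀)).addSubgroupOf
            (F'.comap (incLocIter T π e hkill hker hπ he j v d₀))) := Nat.card_le_card_of_surjective q hq
    _ ≤ Nat.card (↥F' ⧸ (F (j + d₀) v).addSubgroupOf F') := hleC
    _ ≤ Nat.card (↥F' ⧸ core.addSubgroupOf F') * Nat.card (↥core ⧸ (F (j + d₀) v).addSubgroupOf core) := hleF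
    _ ≤ B₁ * B₂ := Nat.mul_le_mul h₁ h₂

end AdicTower

end Literature.NumberTheory.GaloisCohomology.Howard2004
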